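import Summits.CriticalPhenomena.PercolationContinuityZ3.Theorems.SahiMasterFamilyFCombTwoLevelKleitmanHallGround
import Summits.CriticalPhenomena.PercolationContinuityZ3.Theorems.SahiMasterFamilyFCombFaceRouting

/-!
# Sections of a one-sided family and the packaged / chosen data of SCHEME Σ (support file)

Support file (prover seat `prim-bnk-2`, gen 31–32; `--supports stmt-CriticalPhenomena-4575`).  Proof document:
`run/shared/lean/prim/prim-l12/prim-bnk-2/PROOF-THEOREM-I1.md` §0–§1; plan `SIGMA-ASSEMBLY-PLAN.md`.

In SCHEME Σ (THEOREM I₁: Conjecture V, untwisted, for one-shared-coordinate pairs) the family `B` (resp. `C`) depends only on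
the coordinates `I + e` (resp. `J + e`).  On a sub-cube `2^R` (`R ⊆ I`, `e ∉ R`) it is seen through its two SECTIONS
`secLow R B = {t ⊆ R : t ∈ B}` (`B⁰|_R`) and `secHigh R e B = {t ⊆ R : t + e ∈ B}` (`B¹|_R`), nested up-sets of `2^R`.  Part 1–4:
* the section families and their bookkeeping (`mem_secLow`, `mem_secHigh`, `secLow_subset_secHigh`, up-closedness);
* `exists_kleitmanHall_secLow`: Kleitman–Hall for a section on any ground finset (covers the row families `C′ = secLow ((J \ x_J) + e) C`);
* `downs_eq_downs_filter`: `D_l X = D_{l ∩ R} X` for families inside `2^R`, and `filter_disjoint_eq_sdiff_sec`;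
* **`oneShared_cubeData`**: for `R`, `e` and ANY duplicate-free list `l` enumerating `R`, the complete cube data of PROOF-THEOREM-I1 §1
  in prenex form: the canonical down-set `A = D_l (B¹|_R \ B⁰|_R)` (`A ⊆ a`, down-closed) and the upward bijections
  `τ, G_b, G_T, Φ_c, Φ_ℓ` (`twoLevel_data`) together with the Kleitman–Hall bijection `g₀ : L(B⁰|_R) ≅↑ H(B⁰|_R)`.
Part 5–7 BUNDLE and CHOOSE these data once and for all (`Classical.choice`), so that the unit map `φ` can be ONE top-level definition:
* `CubeData R e B l` / `cubeData …` (from `oneShared_cubeData`); `KHData S B` / `khData …` (from `exists_kleitmanHall_secLow`);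
* `RoutingData J e C` / `routingData …` — the leaver family `𝓟` of LEMMA J** for `Δ = C¹|_J \ C⁰|_J` with the list `J.sort` and the
  routing bijection `ρ` (from `exists_face_routing`), plus `routing_A_eq` (its `A w` is the `A` of `cubeData` on `J \ w` with the list
  `(J.sort).filter (· ∈ J \ w)`) and `sort_filter_enumerates`.
Plumbing definitions (`secLow`, `secHigh`, three structures, three choices); no `sorry`; standard axioms.
-/

namespace Summit.CriticalPhenomena.PercolationContinuityZ3.Theorems

namespace SahiFComb.Shift

open Finset FinsetFamily

variable {α : Type*} [DecidableEq α]

/-! ### 1. Sections -/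

/-- Lower section of a family on the sub-cube `2^R`: `B⁰|_R = {t ⊆ R : t ∈ B}`. [this work] -/
def secLow (R : Finset α) (B : Finset (Finset α)) : Finset (Finset α) := R.powerset.filter (· ∈ B)

/-- Upper section along `e` of a family on the sub-cube `2^R`: `B¹|_R = {t ⊆ R : t + e ∈ B}`. [this work] -/
def secHigh (R : Finset α) (e : α) (B : Finset (Finset α)) : Finset (Finset α) := R.powerset.filter fun t => insert e t ∈ B

/-- Membership in the lower section. [this work] -/
theorem mem_secLow {R : Finset α} {B : Finset (Finset α)} {t : Finset α} : t ∈ secLow R B ↔ t ⊆ R ∧ t ∈ B := by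
  rw [secLow, mem_filter, mem_powerset]

/-- Membership in the upper section. [this work] -/
theorem mem_secHigh {R : Finset α} {e : α} {B : Finset (Finset α)} {t : Finset α} :
    t ∈ secHigh R e B ↔ t ⊆ R ∧ insert e t ∈ B := by
  rw [secHigh, mem_filter, mem_powerset]

section Ground

variable {V : Finset α} {B : Finset (Finset α)} (hBup : ∀ s ∈ B, ∀ s', s ⊆ s' → s' ⊆ V → s' ∈ B)
include hBup

/-- The sections are nested: `B⁰|_R ⊆ B¹|_R`. [this work] -/
theorem secLow_subset_secHigh {R : Finset α} {e : α} (hRV : R ⊆ V) (heV : e ∈ V) : secLow R B ⊆ secHigh R e B := by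
  intro t ht
  rw [mem_secLow] at ht
  rw [mem_secHigh]
  exact ⟨ht.1, hBup t ht.2 _ (subset_insert e t) (insert_subset heV (ht.1.trans hRV))⟩

/-- The lower section is up-closed inside `2^R`. [this work] -/
theorem secLow_upClosed {R : Finset α} (hRV : R ⊆ V) :
    ∀ K ∈ secLow R B, ∀ K', K ⊆ K' → K' ⊆ R → K' ∈ secLow R B := by
  intro K hK K' hKK' hK'R
  rw [mem_secLow] at hK ⊢
  exact ⟨hK'R, hBup K hK.2 K' hKK' (hK'R.trans hRV)⟩

/-- The upper section is up-closed inside `2^R`. [this work] -/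
theorem secHigh_upClosed {R : Finset α} {e : α} (hRV : R ⊆ V) (heV : e ∈ V) :
    ∀ K ∈ secHigh R e B, ∀ K', K ⊆ K' → K' ⊆ R → K' ∈ secHigh R e B := by
  intro K hK K' hKK' hK'R
  rw [mem_secHigh] at hK ⊢
  exact ⟨hK'R, hBup _ hK.2 _ (insert_subset_insert e hKK') (insert_subset heV (hK'R.trans hRV))⟩

/-! ### 2. Kleitman–Hall for a section -/

/-- **Kleitman–Hall for a section**: for `S ⊆ V` and `P = B⁰|_S` there is a bijection `g : σ_S P \ P ≃ P \ σ_S P` with `x ⊆ g x`.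
(For the row families of SCHEME Σ take `S = (J \ x_J) + e`.) [this work] -/
theorem exists_kleitmanHall_secLow [LinearOrder α] {S : Finset α} (hSV : S ⊆ V) :
    ∃ g : ↥((secLow S B).image (fun t => S \ t) \ secLow S B) ≃ ↥(secLow S B \ (secLow S B).image fun t => S \ t),
      ∀ x : ↥((secLow S B).image (fun t => S \ t) \ secLow S B), (x : Finset α) ⊆ (g x : Finset α) := by
  have h := exists_dominating_equiv_ground S (secLow S B) (fun s hs => (mem_secLow.1 hs).1) (secLow_upClosed hBup hSV)
    [] List.nodup_nil (fun _ h => absurd h List.not_mem_nil) ((secLow S B).image (fun t => S \ t) ∩ secLow S B) rfl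
  have hmem : ∀ s ∈ (secLow S B).image (fun t => S \ t) ∩ secLow S B, s ⊆ S := fun s hs =>
    (mem_secLow.1 (mem_inter.1 hs).2).1
  have hsub : ((secLow S B).image (fun t => S \ t) ∩ secLow S B).image (fun t => S \ t) ⊆
      (secLow S B).image fun t => S \ t := image_subset_image inter_subset_right
  have hsup : (secLow S B).image (fun t => S \ t) ∩ secLow S B ⊆
      ((secLow S B).image (fun t => S \ t) ∩ secLow S B).image (fun t => S \ t) := by
    intro s hs
    obtain ⟨hs1, hs2⟩ := mem_inter.1 hs
    rw [mem_image_ground_sdiff S (fun t ht => (mem_secLow.1 ht).1)] at hs1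
    refine (mem_image_ground_sdiff S hmem).2 ⟨hs1.1, mem_inter.2 ⟨?_, hs1.2⟩⟩
    refine (mem_image_ground_sdiff S (fun t ht => (mem_secLow.1 ht).1)).2 ⟨sdiff_subset, ?_⟩
    rwa [sdiff_sdiff_right_self, inf_eq_inter, inter_eq_right.2 hs1.1]
  -- `σ(σP ∩ P) = σP ∩ P`, so the target is `P \ σP`
  have heq : secLow S B \ ((secLow S B).image (fun t => S \ t) ∩ secLow S B).image (fun t => S \ t) =
      secLow S B \ (secLow S B).image fun t => S \ t := by
    ext s
    simp only [mem_sdiff]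
    constructor
    · rintro ⟨hs, hn⟩
      exact ⟨hs, fun h => hn (hsup (mem_inter.2 ⟨h, hs⟩))⟩
    · rintro ⟨hs, hn⟩
      exact ⟨hs, fun h => hn (hsub h)⟩
  rw [heq] at h
  exact h

end Ground

/-! ### 3. List bookkeeping and the restricted difference family -/

/-- Down-compressions along coordinates outside `R` do nothing to a family inside `2^R`: `D_l X = D_{l ∩ R} X`. [this work] -/
theorem downs_eq_downs_filter (R : Finset α) :
    ∀ (l : List α) (X : Finset (Finset α)), (∀ s ∈ X, s ⊆ R) →
      l.foldl (fun 𝒴 i => 𝓓 i 𝒴) X = (l.filter (· ∈ R)).foldl (fun 𝒴 i => 𝓓 i 𝒴) X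
  | [], _, _ => rfl
  | a :: l, X, hX => by
    rw [List.foldl_cons]
    by_cases ha : a ∈ R
    · rw [List.filter_cons_of_pos (by simpa using ha), List.foldl_cons]
      exact downs_eq_downs_filter R l _ (subset_ground_of_mem_compression R hX a)
    · rw [List.filter_cons_of_neg (by simpa using ha),
        compression_eq_self_of_forall_notMem (fun s hs has => ha (hX s hs has))]
      exact downs_eq_downs_filter R l X hX

/-- The list `l ∩ R` enumerates `R` without duplicates when `l ⊇ R` is duplicate-free. [folklore] -/
theorem filter_mem_enumerates {R : Finset α} {l : List α} (hl : l.Nodup) (hR : ∀ a ∈ R, a ∈ l) :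
    (l.filter (· ∈ R)).Nodup ∧ (∀ a ∈ l.filter (· ∈ R), a ∈ R) ∧ (∀ a ∈ R, a ∈ l.filter (· ∈ R)) := by
  refine ⟨hl.filter _, fun a ha => ?_, fun a ha => ?_⟩
  · simpa using (List.mem_filter.1 ha).2
  · exact List.mem_filter.2 ⟨hR a ha, by simpa using ha⟩

/-- The restricted difference family of LEMMA J** is the difference of the sections on the sub-cube:
`{s ∈ B¹|_J \ B⁰|_J : s ∩ w = ∅} = B¹|_{J\w} \ B⁰|_{J\w}`. [this work] -/
theorem filter_disjoint_eq_sdiff_sec (J w : Finset α) (e : α) (B : Finset (Finset α)) :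
    ((secHigh J e B \ secLow J B).filter fun s => Disjoint s w) = secHigh (J \ w) e B \ secLow (J \ w) B := by
  ext s
  simp only [mem_filter, mem_sdiff, mem_secHigh, mem_secLow, subset_sdiff, not_and]
  tauto

/-! ### 4. The packaged cube data -/

/-- **The data of SCHEME Σ on one sub-cube** (PROOF-THEOREM-I1 §1, prenex form).  Let `B` be up-closed inside `2^V`, `R ⊆ V`,
`e ∈ V \ R`, `l` a duplicate-free list enumerating `R`; `P = B⁰|_R`, `Q = B¹|_R`, `σ = R \ ·`.  Then there are `A` and bijections
`τ : A ≃ Q \ P`, `G_b : (σQ \ P) \ A ≃ P \ σQ`, `G_T : A ≃ σA`, `Φ_c : σP \ Q ≃ (Q \ σP) \ σA`, `Φ_ℓ : σ(Q \ P) ≃ σA`,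
`g₀ : σP \ P ≃ P \ σP`, all upward (`x ⊆ f x`), with `A = D_l (Q \ P) ⊆ σQ \ P` down-closed. [this work] -/
theorem oneShared_cubeData [LinearOrder α] {V : Finset α} {B : Finset (Finset α)}
    (hBup : ∀ s ∈ B, ∀ s', s ⊆ s' → s' ⊆ V → s' ∈ B) {R : Finset α} {e : α} (hRV : R ⊆ V) (heV : e ∈ V)
    (l : List α) (hl : l.Nodup) (hlR : ∀ a ∈ l, a ∈ R) (hRl : ∀ a ∈ R, a ∈ l) :
    ∃ (A : Finset (Finset α))
      (τ : ↥A ≃ ↥(secHigh R e B \ secLow R B))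
      (Gb : ↥(((secHigh R e B).image (fun t => R \ t) \ secLow R B) \ A) ≃ ↥(secLow R B \ (secHigh R e B).image fun t => R \ t))
      (GT : ↥A ≃ ↥(A.image fun t => R \ t))
      (Φc : ↥((secLow R B).image (fun t => R \ t) \ secHigh R e B) ≃
        ↥((secHigh R e B \ (secLow R B).image fun t => R \ t) \ A.image fun t => R \ t))
      (Φl : ↥((secHigh R e B \ secLow R B).image fun t => R \ t) ≃ ↥(A.image fun t => R \ t))
      (g₀ : ↥((secLow R B).image (fun t => R \ t) \ secLow R B) ≃ ↥(secLow R B \ (secLow R B).image fun t => R \ t)),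
      A = l.foldl (fun 𝒴 i => 𝓓 i 𝒴) (secHigh R e B \ secLow R B) ∧
      A ⊆ (secHigh R e B).image (fun t => R \ t) \ secLow R B ∧ (∀ K ∈ A, ∀ K' ⊆ K, K' ∈ A) ∧
      (∀ x : ↥A, (x : Finset α) ⊆ (τ x : Finset α)) ∧
      (∀ x : ↥(((secHigh R e B).image (fun t => R \ t) \ secLow R B) \ A), (x : Finset α) ⊆ (Gb x : Finset α)) ∧
      (∀ x : ↥A, (x : Finset α) ⊆ (GT x : Finset α)) ∧
      (∀ x : ↥((secLow R B).image (fun t => R \ t) \ secHigh R e B), (x : Finset α) ⊆ (Φc x : Finset α)) ∧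
      (∀ x : ↥((secHigh R e B \ secLow R B).image fun t => R \ t), (x : Finset α) ⊆ (Φl x : Finset α)) ∧
      (∀ x : ↥((secLow R B).image (fun t => R \ t) \ secLow R B), (x : Finset α) ⊆ (g₀ x : Finset α)) := by
  obtain ⟨hAa, hdown, ⟨τ, hτ⟩, ⟨Gb, hGb⟩, ⟨GT, hGT⟩, ⟨Φc, hΦc⟩, ⟨Φl, hΦl⟩⟩ :=
    twoLevel_data R (secLow R B) (secHigh R e B) (fun s hs => (mem_secHigh.1 hs).1) (secLow_upClosed hBup hRV)
      (secHigh_upClosed hBup hRV heV) (secLow_subset_secHigh hBup hRV heV) l hl hlR hRl _ rfl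
  obtain ⟨g₀, hg₀⟩ := exists_kleitmanHall_secLow hBup hRV
  exact ⟨_, τ, Gb, GT, Φc, Φl, g₀, rfl, hAa, hdown, hτ, hGb, hGT, hΦc, hΦl, hg₀⟩

/-! ### 5. Cube data, bundled and chosen -/

/-- The data of SCHEME Σ on the sub-cube `2^R` for a family `B` (sections along `e`), with the compression list `l`:
the canonical down-set `A = D_l (B¹|_R \ B⁰|_R)` and the upward bijections `τ, G_b, G_T, Φ_c, Φ_ℓ, g₀` (PROOF-THEOREM-I1 §1). [this work] -/
structure CubeData (R : Finset α) (e : α) (B : Finset (Finset α)) (l : List α) where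
  /-- the canonical down-set `A = D_l (Q \ P)` -/
  A : Finset (Finset α)
  /-- `τ : A ≅↑ Q \ P` -/
  τ : ↥A ≃ ↥(secHigh R e B \ secLow R B)
  /-- `G_b : (σQ \ P) \ A ≅↑ P \ σQ` -/
  Gb : ↥(((secHigh R e B).image (fun t => R \ t) \ secLow R B) \ A) ≃ ↥(secLow R B \ (secHigh R e B).image fun t => R \ t)
  /-- `G_T : A ≅↑ σA` -/
  GT : ↥A ≃ ↥(A.image fun t => R \ t)
  /-- `Φ_c : σP \ Q ≅↑ (Q \ σP) \ σA` -/
  Φc : ↥((secLow R B).image (fun t => R \ t) \ secHigh R e B) ≃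
    ↥((secHigh R e B \ (secLow R B).image fun t => R \ t) \ A.image fun t => R \ t)
  /-- `Φ_ℓ : σ(Q \ P) ≅↑ σA` -/
  Φl : ↥((secHigh R e B \ secLow R B).image fun t => R \ t) ≃ ↥(A.image fun t => R \ t)
  /-- `g₀ : σP \ P ≅↑ P \ σP` (Kleitman–Hall for `P = B⁰|_R`) -/
  g₀ : ↥((secLow R B).image (fun t => R \ t) \ secLow R B) ≃ ↥(secLow R B \ (secLow R B).image fun t => R \ t)
  hA : A = l.foldl (fun 𝒴 i => 𝓓 i 𝒴) (secHigh R e B \ secLow R B)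
  hAa : A ⊆ (secHigh R e B).image (fun t => R \ t) \ secLow R B
  hdown : ∀ K ∈ A, ∀ K' ⊆ K, K' ∈ A
  hτ : ∀ x : ↥A, (x : Finset α) ⊆ (τ x : Finset α)
  hGb : ∀ x : ↥(((secHigh R e B).image (fun t => R \ t) \ secLow R B) \ A), (x : Finset α) ⊆ (Gb x : Finset α)
  hGT : ∀ x : ↥A, (x : Finset α) ⊆ (GT x : Finset α)
  hΦc : ∀ x : ↥((secLow R B).image (fun t => R \ t) \ secHigh R e B), (x : Finset α) ⊆ (Φc x : Finset α)
  hΦl : ∀ x : ↥((secHigh R e B \ secLow R B).image fun t => R \ t), (x : Finset α) ⊆ (Φl x : Finset α)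
  hg₀ : ∀ x : ↥((secLow R B).image (fun t => R \ t) \ secLow R B), (x : Finset α) ⊆ (g₀ x : Finset α)

/-- The cube data exist (`oneShared_cubeData`). [this work] -/
theorem nonempty_cubeData [LinearOrder α] {V : Finset α} {B : Finset (Finset α)}
    (hBup : ∀ s ∈ B, ∀ s', s ⊆ s' → s' ⊆ V → s' ∈ B) {R : Finset α} {e : α} (hRV : R ⊆ V) (heV : e ∈ V)
    {l : List α} (hl : l.Nodup) (hlR : ∀ a ∈ l, a ∈ R) (hRl : ∀ a ∈ R, a ∈ l) : Nonempty (CubeData R e B l) := by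
  obtain ⟨A, τ, Gb, GT, Φc, Φl, g₀, hA, hAa, hdown, hτ, hGb, hGT, hΦc, hΦl, hg₀⟩ :=
    oneShared_cubeData hBup hRV heV l hl hlR hRl
  exact ⟨⟨A, τ, Gb, GT, Φc, Φl, g₀, hA, hAa, hdown, hτ, hGb, hGT, hΦc, hΦl, hg₀⟩⟩

/-- A choice of the cube data. [this work] -/
noncomputable def cubeData [LinearOrder α] {V : Finset α} {B : Finset (Finset α)}
    (hBup : ∀ s ∈ B, ∀ s', s ⊆ s' → s' ⊆ V → s' ∈ B) {R : Finset α} {e : α} (hRV : R ⊆ V) (heV : e ∈ V)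
    {l : List α} (hl : l.Nodup) (hlR : ∀ a ∈ l, a ∈ R) (hRl : ∀ a ∈ R, a ∈ l) : CubeData R e B l :=
  Classical.choice (nonempty_cubeData hBup hRV heV hl hlR hRl)

/-! ### 6. Kleitman–Hall data of a section -/

/-- A Kleitman–Hall bijection for the section `P = B⁰|_S`: `g : σ_S P \ P ≅↑ P \ σ_S P`. [this work] -/
structure KHData (S : Finset α) (B : Finset (Finset α)) where
  /-- the bijection -/
  g : ↥((secLow S B).image (fun t => S \ t) \ secLow S B) ≃ ↥(secLow S B \ (secLow S B).image fun t => S \ t)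
  hg : ∀ x : ↥((secLow S B).image (fun t => S \ t) \ secLow S B), (x : Finset α) ⊆ (g x : Finset α)

/-- The Kleitman–Hall data exist (`exists_kleitmanHall_secLow`). [this work] -/
theorem nonempty_khData [LinearOrder α] {V : Finset α} {B : Finset (Finset α)}
    (hBup : ∀ s ∈ B, ∀ s', s ⊆ s' → s' ⊆ V → s' ∈ B) {S : Finset α} (hSV : S ⊆ V) : Nonempty (KHData S B) := by
  obtain ⟨g, hg⟩ := exists_kleitmanHall_secLow hBup hSV
  exact ⟨⟨g, hg⟩⟩

/-- A choice of the Kleitman–Hall data. [this work] -/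
noncomputable def khData [LinearOrder α] {V : Finset α} {B : Finset (Finset α)}
    (hBup : ∀ s ∈ B, ∀ s', s ⊆ s' → s' ⊆ V → s' ∈ B) {S : Finset α} (hSV : S ⊆ V) : KHData S B :=
  Classical.choice (nonempty_khData hBup hSV)

/-! ### 7. Routing data -/

/-- The routing data of LEMMA J** for the family `C` on `J` (sections along `e`), with the list `J.sort (· ≤ ·)`:
the leaver family `𝓟` and the routing bijection `ρ` with `x_J ⊆ x'`, `y_J ⊆ y'`. [this work] -/
structure RoutingData [LinearOrder α] (J : Finset α) (e : α) (C : Finset (Finset α)) where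
  /-- the leaver family `{(w,t) : w,t ⊆ J, w ∩ t = ∅, J \ (w ∪ t) ∈ A w}` -/
  𝓟 : Finset (Finset α × Finset α)
  /-- the routing bijection -/
  ρ : ↥𝓟 ≃ ↥𝓟
  h𝓟 : 𝓟 = {p ∈ J.powerset ×ˢ J.powerset | Disjoint p.1 p.2 ∧
    J \ (p.1 ∪ p.2) ∈ (J.sort (· ≤ ·)).foldl (fun 𝒴 i => 𝓓 i 𝒴)
      ((secHigh J e C \ secLow J C).filter fun s => Disjoint s p.1)}
  hρ : ∀ f : ↥𝓟, (f : Finset α × Finset α).1 ⊆ ((ρ f : ↥𝓟) : Finset α × Finset α).2 ∧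
    J \ ((f : Finset α × Finset α).1 ∪ (f : Finset α × Finset α).2) ⊆ ((ρ f : ↥𝓟) : Finset α × Finset α).1

/-- The routing data exist (`exists_face_routing`). [this work] -/
theorem nonempty_routingData [LinearOrder α] (J : Finset α) (e : α) (C : Finset (Finset α)) :
    Nonempty (RoutingData J e C) := by
  have hJ : (J.sort (· ≤ ·)).toFinset = J := by
    ext; rw [List.mem_toFinset, mem_sort]
  obtain ⟨ρ, hρ⟩ := exists_face_routing (J.sort (· ≤ ·)) (sort_nodup _ _) (secHigh J e C \ secLow J C)
    (fun w => (J.sort (· ≤ ·)).foldl (fun 𝒴 i => 𝓓 i 𝒴) ((secHigh J e C \ secLow J C).filter fun s => Disjoint s w))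
    (fun _ => rfl)
    ({p ∈ J.powerset ×ˢ J.powerset | Disjoint p.1 p.2 ∧
      J \ (p.1 ∪ p.2) ∈ (J.sort (· ≤ ·)).foldl (fun 𝒴 i => 𝓓 i 𝒴)
        ((secHigh J e C \ secLow J C).filter fun s => Disjoint s p.1)})
    (by rw [hJ])
  rw [hJ] at hρ
  exact ⟨⟨_, ρ, rfl, hρ⟩⟩

/-- A choice of the routing data. [this work] -/
noncomputable def routingData [LinearOrder α] (J : Finset α) (e : α) (C : Finset (Finset α)) : RoutingData J e C :=
  Classical.choice (nonempty_routingData J e C)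

/-- The `A w` of the routing is the `A` of the cube data of `C` on `J \ w` taken with the filtered list. [this work] -/
theorem routing_A_eq [LinearOrder α] (J w : Finset α) (e : α) (C : Finset (Finset α)) :
    (J.sort (· ≤ ·)).foldl (fun 𝒴 i => 𝓓 i 𝒴) ((secHigh J e C \ secLow J C).filter fun s => Disjoint s w) =
      ((J.sort (· ≤ ·)).filter (· ∈ J \ w)).foldl (fun 𝒴 i => 𝓓 i 𝒴) (secHigh (J \ w) e C \ secLow (J \ w) C) := by
  rw [filter_disjoint_eq_sdiff_sec]
  exact downs_eq_downs_filter (J \ w) _ _ fun s hs => (mem_secHigh.1 (mem_sdiff.1 hs).1).1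

/-- The filtered sorted list enumerates `J \ w` (hypotheses of `cubeData` for the J-cubes). [this work] -/
theorem sort_filter_enumerates [LinearOrder α] (J w : Finset α) :
    ((J.sort (· ≤ ·)).filter (· ∈ J \ w)).Nodup ∧ (∀ a ∈ (J.sort (· ≤ ·)).filter (· ∈ J \ w), a ∈ J \ w) ∧
      (∀ a ∈ J \ w, a ∈ (J.sort (· ≤ ·)).filter (· ∈ J \ w)) :=
  filter_mem_enumerates (sort_nodup _ _) fun _ ha => (mem_sort _).2 (mem_sdiff.1 ha).1

end SahiFComb.Shift

end Summit.CriticalPhenomena.PercolationContinuityZ3.Theorems
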